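import Mathlib

/-!
# The game-time quantifier game `Force` (hp-7 gen 83): infrastructure for order-shattering domination theorems

Helper file for crux `stmt-CriticalPhenomena-4575` (`NoHeavyLowerTail`, route `PercNearOneGluingNoHeavy`), hull-port seat `prim-hp-7`
(generation 83); `--supports stmt-CriticalPhenomena-4575`.  Pure finite set theory; everything is PROVED.
Memo: `run/shared/lean/prim/prim-hp-7/FROM-prim-hp-7-g83-GAME-COUNT.md` §0quater (U).

**The game.**  A play assigns bits to the coordinates of a list `lg : List (α × Bool)` in order (game time: head first); at a
coordinate tagged `true` the ∃-player (Verifier) chooses the bit, at a coordinate tagged `false` the ∀-player does.  Starting from the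
set `S` of coordinates already set to one, `Force lg X S` says that Verifier can force the final set of ones to lie in the family `X`.
(Read from the innermost quantifier this is the order-shattering / sectioning game of `…LowerTailGameCount`; here only the game-time
recursion is needed.)

**Used by** `…LowerTailTwoPetalOrderShattering` (`force_twoPetal`):  Let `P, Q` be up-sets of subsets of a ground set `U` and put
`X = {t : (t ∈ P ∧ U \ t ∈ Q) ∨ (t ∈ Q ∧ U \ t ∈ P)}` ("the two monotone events disagree across the antipode") and
`Y = {t : (t ∈ P ∧ t ∈ Q) ∨ (U \ t ∈ P ∧ U \ t ∈ Q)}` ("they agree").  Then for EVERY coordinate order and EVERY quantifier pattern,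
if Verifier can force `X` she can force `Y`.  For the two petals of a monotone pair `(g,h)` (`P = {g ≥ C_a}`-type up-sets) `X` is the
family of debtor sets and `Y` the family of resolved sets, so this is the two-petal case of the gen-83 debtor-game conjecture in its
strongest (every-order) form; counting won words gives back `#X ≤ #Y` (Harris–Kleitman, `kSharp_two`).  Three petals fail in some
orders from `n = 6` on (memo §0 (D)); the proof below pin-points why (memo §0quater (V): the 'drift').

**Proof.**  Verifier follows an `X`-winning strategy and switches to the constant strategy `1` (resp. `0`) as soon as
`F = ones ∪ (her remaining coordinates)` (resp. `G = zeros ∪ (her remaining coordinates)`) lies in `P ∩ Q`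
(`force_of_upper`, `force_of_lower`).  If no switch ever occurs, the all-`0` and all-`1` continuations of the winning strategy
(`exists_low_of_force`, `exists_high_of_force`) show that `F` and `G` each lie in `P ∪ Q`, hence in exactly one of `P`, `Q`; one
coordinate enters or leaves at a time, so by monotonicity this 'colour' never changes, and `F = G` at the start — but at the end
`F = s`, `G = U \ s` with `s ∈ X \ Y` have different colours.  The formal proof runs this as an induction on the remaining game with
the invariant `Agree` (`force_twoPetal_aux`).
-/

namespace Summit.CriticalPhenomena.PercolationContinuityZ3.Theorems

namespace TwoPetalGame

open Finset

variable {α : Type*} [DecidableEq α]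

/-- `Force lg X S`: with the coordinates in `lg` still to be played in order (tag `true` = Verifier's move, `false` = Adversary's),
and `S` the set of coordinates already set to one, Verifier can force the final set into `X`. -/
def Force : List (α × Bool) → Finset (Finset α) → Finset α → Prop
  | [], X, S => S ∈ X
  | (x, true) :: lg, X, S => Force lg X S ∨ Force lg X (insert x S)
  | (x, false) :: lg, X, S => Force lg X S ∧ Force lg X (insert x S)

/-- Verifier's remaining coordinates. -/
def evars : List (α × Bool) → Finset α
  | [] => ∅
  | (x, true) :: lg => insert x (evars lg)
  | (_, false) :: lg => evars lg

/-- All remaining coordinates. -/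
def allvars : List (α × Bool) → Finset α
  | [] => ∅
  | (x, _) :: lg => insert x (allvars lg)

/-- Verifier's remaining coordinates are among all remaining coordinates. -/
theorem evars_subset_allvars : ∀ lg : List (α × Bool), evars lg ⊆ allvars lg
  | [] => by simp [evars, allvars]
  | (x, true) :: lg => by
      simp only [evars, allvars]
      exact insert_subset_insert x (evars_subset_allvars lg)
  | (x, false) :: lg => by
      simp only [evars, allvars]
      exact (evars_subset_allvars lg).trans (subset_insert x _)

/-- `Force` is monotone in the target family. -/
theorem Force.mono : ∀ (lg : List (α × Bool)) {X Y : Finset (Finset α)} (S : Finset α), X ⊆ Y → Force lg X S → Force lg Y S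
  | [], X, Y, S, h, hf => h hf
  | (x, true) :: lg, X, Y, S, h, hf => by
      simp only [Force] at hf ⊢
      exact hf.imp (Force.mono lg S h) (Force.mono lg (insert x S) h)
  | (x, false) :: lg, X, Y, S, h, hf => by
      simp only [Force] at hf ⊢
      exact ⟨Force.mono lg S h hf.1, Force.mono lg (insert x S) h hf.2⟩

/-- The all-`0` adversary: from a winning position there is a member of `X` between `S` and `S ∪ evars`. -/
theorem exists_low_of_force : ∀ (lg : List (α × Bool)) (X : Finset (Finset α)) (S : Finset α),
    Force lg X S → ∃ T ∈ X, S ⊆ T ∧ T ⊆ S ∪ evars lg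
  | [], X, S, hf => ⟨S, hf, subset_refl S, by simp [evars]⟩
  | (x, true) :: lg, X, S, hf => by
      simp only [Force] at hf
      rcases hf with hf | hf
      · obtain ⟨T, hT, h1, h2⟩ := exists_low_of_force lg X S hf
        refine ⟨T, hT, h1, h2.trans ?_⟩
        simp only [evars]
        exact union_subset_union (subset_refl S) (subset_insert x _)
      · obtain ⟨T, hT, h1, h2⟩ := exists_low_of_force lg X (insert x S) hf
        refine ⟨T, hT, (subset_insert x S).trans h1, h2.trans ?_⟩
        simp only [evars]
        intro y hy
        rcases mem_union.mp hy with hy | hy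
        · rcases mem_insert.mp hy with rfl | hy
          · exact mem_union_right _ (mem_insert_self _ _)
          · exact mem_union_left _ hy
        · exact mem_union_right _ (mem_insert_of_mem hy)
  | (x, false) :: lg, X, S, hf => by
      simp only [Force] at hf
      obtain ⟨T, hT, h1, h2⟩ := exists_low_of_force lg X S hf.1
      exact ⟨T, hT, h1, h2.trans (by simp only [evars]; exact subset_refl _)⟩

/-- The all-`1` adversary: from a winning position there is a member of `X` containing `S` and all of the adversary's remaining
coordinates, inside `S ∪ allvars`. -/
theorem exists_high_of_force : ∀ (lg : List (α × Bool)) (X : Finset (Finset α)) (S : Finset α),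
    Force lg X S → ∃ T ∈ X, S ∪ (allvars lg \ evars lg) ⊆ T ∧ T ⊆ S ∪ allvars lg
  | [], X, S, hf => ⟨S, hf, by simp [allvars, evars], by simp [allvars]⟩
  | (x, true) :: lg, X, S, hf => by
      simp only [Force] at hf
      have key : ∀ S' : Finset α, S' = S ∨ S' = insert x S → Force lg X S' →
          ∃ T ∈ X, S ∪ (allvars ((x, true) :: lg) \ evars ((x, true) :: lg)) ⊆ T ∧ T ⊆ S ∪ allvars ((x, true) :: lg) := by
        intro S' hS' hf'
        obtain ⟨T, hT, h1, h2⟩ := exists_high_of_force lg X S' hf'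
        refine ⟨T, hT, ?_, ?_⟩
        · intro y hy
          rcases mem_union.mp hy with hy | hy
          · apply h1; apply mem_union_left
            rcases hS' with rfl | rfl
            · exact hy
            · exact mem_insert_of_mem hy
          · simp only [allvars, evars, mem_sdiff, mem_insert] at hy
            obtain ⟨hy1, hy2⟩ := hy
            rw [not_or] at hy2
            rcases hy1 with rfl | hy1
            · exact absurd rfl hy2.1
            · exact h1 (mem_union_right _ (mem_sdiff.mpr ⟨hy1, hy2.2⟩))
        · intro y hy
          have := h2 hy
          simp only [allvars]
          rcases mem_union.mp this with h | h
          · rcases hS' with rfl | rfl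
            · exact mem_union_left _ h
            · rcases mem_insert.mp h with rfl | h
              · exact mem_union_right _ (mem_insert_self _ _)
              · exact mem_union_left _ h
          · exact mem_union_right _ (mem_insert_of_mem h)
      rcases hf with hf | hf
      · exact key S (Or.inl rfl) hf
      · exact key (insert x S) (Or.inr rfl) hf
  | (x, false) :: lg, X, S, hf => by
      simp only [Force] at hf
      obtain ⟨T, hT, h1, h2⟩ := exists_high_of_force lg X (insert x S) hf.2
      refine ⟨T, hT, ?_, ?_⟩
      · intro y hy
        apply h1
        simp only [allvars, evars, mem_union, mem_sdiff, mem_insert] at hy ⊢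
        rcases hy with hy | ⟨hy1, hy2⟩
        · exact Or.inl (Or.inr hy)
        · rcases hy1 with rfl | hy1
          · exact Or.inl (Or.inl rfl)
          · exact Or.inr ⟨hy1, hy2⟩
      · intro y hy
        have := h2 hy
        simp only [allvars, mem_union, mem_insert] at this ⊢
        rcases this with h | h
        · rcases h with rfl | h
          · exact Or.inr (Or.inl rfl)
          · exact Or.inl h
        · exact Or.inr (Or.inr h)

/-- The constant-`1` strategy: if every set between `S ∪ evars` and `S ∪ allvars` lies in `Y`, Verifier forces `Y`. -/
theorem force_of_upper : ∀ (lg : List (α × Bool)) (Y : Finset (Finset α)) (S : Finset α),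
    (∀ T : Finset α, S ∪ evars lg ⊆ T → T ⊆ S ∪ allvars lg → T ∈ Y) → Force lg Y S
  | [], Y, S, h => by
      have := h S (by simp [evars]) (by simp [allvars])
      exact this
  | (x, true) :: lg, Y, S, h => by
      simp only [Force]
      refine Or.inr (force_of_upper lg Y (insert x S) fun T h1 h2 => h T ?_ ?_)
      · intro y hy
        simp only [evars, mem_union, mem_insert] at hy
        apply h1
        simp only [mem_union, mem_insert]
        tauto
      · intro y hy
        have := h2 hy
        simp only [allvars, mem_union, mem_insert] at this ⊢
        tauto
  | (x, false) :: lg, Y, S, h => by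
      simp only [Force]
      refine ⟨force_of_upper lg Y S (fun T h1 h2 => h T ?_ ?_), force_of_upper lg Y (insert x S) (fun T h1 h2 => h T ?_ ?_)⟩
      · intro y hy; apply h1; simp only [evars, mem_union] at hy ⊢; exact hy
      · intro y hy; have := h2 hy; simp only [allvars, mem_union, mem_insert] at this ⊢; tauto
      · intro y hy; apply h1; simp only [evars, mem_union, mem_insert] at hy ⊢; tauto
      · intro y hy; have := h2 hy; simp only [allvars, mem_union, mem_insert] at this ⊢; tauto

/-- No coordinate occurs twice in the remaining game. -/
def Fresh : List (α × Bool) → Prop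
  | [] => True
  | (x, _) :: lg => x ∉ allvars lg ∧ Fresh lg

/-- The constant-`0` strategy: if every set between `S` and `S ∪ (adversary's remaining coordinates)` lies in `Y`, Verifier forces `Y`. -/
theorem force_of_lower : ∀ (lg : List (α × Bool)) (Y : Finset (Finset α)) (S : Finset α), Fresh lg →
    (∀ T : Finset α, S ⊆ T → T ⊆ S ∪ (allvars lg \ evars lg) → T ∈ Y) → Force lg Y S
  | [], Y, S, _, h => by
      have := h S (subset_refl S) (by simp [allvars])
      exact this
  | (x, true) :: lg, Y, S, hfr, h => by
      simp only [Force]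
      simp only [Fresh] at hfr
      refine Or.inl (force_of_lower lg Y S hfr.2 fun T h1 h2 => h T h1 ?_)
      intro y hy
      have := h2 hy
      simp only [allvars, evars, mem_union, mem_sdiff, mem_insert] at this ⊢
      rcases this with h' | ⟨h3, h4⟩
      · exact Or.inl h'
      · refine Or.inr ⟨Or.inr h3, ?_⟩
        rw [not_or]
        exact ⟨fun hyx => hfr.1 (hyx ▸ h3), h4⟩
  | (x, false) :: lg, Y, S, hfr, h => by
      simp only [Force]
      simp only [Fresh] at hfr
      refine ⟨force_of_lower lg Y S hfr.2 (fun T h1 h2 => h T h1 ?_), force_of_lower lg Y (insert x S) hfr.2 (fun T h1 h2 => h T ?_ ?_)⟩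
      · intro y hy; have := h2 hy
        simp only [allvars, evars, mem_union, mem_sdiff, mem_insert] at this ⊢
        rcases this with h' | ⟨h3, h4⟩
        · exact Or.inl h'
        · exact Or.inr ⟨Or.inr h3, h4⟩
      · exact (subset_insert x S).trans h1
      · intro y hy; have := h2 hy
        simp only [allvars, evars, mem_union, mem_sdiff, mem_insert] at this ⊢
        rcases this with h' | ⟨h3, h4⟩
        · rcases h' with rfl | h'
          · by_cases hxe : y ∈ evars lg
            · exact absurd (evars_subset_allvars lg hxe) hfr.1
            · exact Or.inr ⟨Or.inl rfl, hxe⟩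
          · exact Or.inl h'
        · exact Or.inr ⟨Or.inr h3, h4⟩

end TwoPetalGame

end Summit.CriticalPhenomena.PercolationContinuityZ3.Theorems
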